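import Literature.Analysis.FunctionSpaces.SobolevHolderDomain
import Literature.Analysis.FunctionSpaces.MollificationLocal
import Mathlib.Analysis.Calculus.UniformLimitsDeriv
import HarnessLib

/-!
# Continuous weak derivatives are classical; `W^{m+2,2}(ℝ³) ⊂ C^m(ℝ³)`

Analysis/FunctionSpaces support file (all results proved, no definitions, no named facts). Two
steps of the passage from Sobolev regularity of every order to smoothness (R. A. Adams,
*Sobolev Spaces* (1975), Thm 5.4 Part II: `W^{j+m,p}(Ω) → C^j(Ω̄)` for `mp > n`; Evans, *PDE*,
§5.6.3 Thm 6 (ii) "general Sobolev inequalities", proof: "`u ∈ W^{k,p}` ⇒ `D^α u ∈ W^{k-l,p}` ⇒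
Hölder continuous for `|α| ≤ l`"), in the tree's weak-derivative vocabulary
(`HasWeakFDerivOn`, `MemSobolevDomain`):

* `HasWeakFDerivOn.hasFDerivAt_of_continuousOn` — **a continuous function with a continuous weak
  Fréchet derivative on an open set is classically differentiable there, with that derivative**
  (the several-variable du Bois-Reymond lemma). Proof by local mollification: on a ball `V ⋐ U`
  the mollified zero extensions `φ_ε ⋆ 𝟙_V f` are differentiable with derivative
  `∫_V φ_ε(· − z) g(z) dz = φ_ε ⋆ 𝟙_V g` (`HasWeakFDerivOn.hasFDerivAt_normed_convolution_indicator`,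
  `MollificationLocal`), both mollifications converge (locally) uniformly near the point by uniform
  continuity on a compact ball (`ContDiffBump.dist_normed_convolution_le`), and locally uniform
  limits of derivatives are derivatives (Mathlib's `hasFDerivAt_of_tendstoLocallyUniformlyOn`).
* `exists_contDiff_rep_of_memSobolevDomain` — **`W^{m+2,2}(ℝ³) ⊂ C^m(ℝ³)`**: on a three-dimensional
  inner product space (any additive Haar measure), a function with `MemSobolevDomain (m+2) 2 ⊤`
  agrees a.e. with a `C^m` function. Induction on `m` from the continuous representative of
  `W^{2,2}(ℝ³)` (`exists_continuous_rep_holder_eSobolevDomainNorm_two`, `SobolevHolderDomain`): in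
  the step, the function and the components of its weak derivative along an orthonormal basis have
  `C^m` representatives, which assemble to a continuous weak derivative of the representative
  (`MeyersSerrin.hasWeakFDerivOn_congr_ae`), hence a classical one, and
  `contDiff_succ_iff_hasFDerivAt` closes.

With the tree's Calderón–Stein extension (`stein_extension_holds`) this gives continuous
derivatives of all orders, up to the boundary, for functions in `⋂ₖ W^{k,2}(Ω)` on bounded
Lipschitz domains of `ℝ³` (used for the smoothness of weak Neumann solutions on the periodic
cylinder, `FluidPDE/PeriodicCylinderNeumann*`).

## Mathlib / tree search

`lean search 'hasFDerivAt_of.*[Ww]eak|weak.*classical'` — tree: `WeakTimeDerivativeClassical`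
(one time variable, `∂ₜw = g`), `DuBoisReymond` (1-D); nothing for Fréchet weak derivatives in
several variables. `lean search 'contDiff.*MemSobolevDomain|MemSobolevDomain.*[Cc]ontinuous'` —
only the order-two representative theorems of `SobolevHolderDomain`/`SobolevSupBoundDomain`.
Used from Mathlib: `ContDiffBump`, `ContDiffBump.dist_normed_convolution_le`, `convolution_def`,
`integral_sub_left_eq_self`, `hasFDerivAt_of_tendstoLocallyUniformlyOn`,
`IsCompact.uniformContinuousOn_of_continuous`, `contDiff_succ_iff_hasFDerivAt`,
`OrthonormalBasis.sum_repr'`, `MemLp.of_bound`.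

## References

* R. A. Adams, *Sobolev Spaces*, Academic Press (1975), Thm 5.4 Part II, Lemma 5.17. [Adams1975]
* L. C. Evans, *Partial Differential Equations*, 2nd ed., AMS GSM 19 (2010), §5.3.1 Thm 1,
  §5.6.3 Thm 6. [Evans2010]
-/

noncomputable section

open MeasureTheory Metric Set Filter Topology Module TopologicalSpace Function
open scoped ENNReal NNReal ContDiff Convolution InnerProductSpace

namespace Literature.Analysis.FunctionSpaces

section WeakToClassical

variable {E : Type*} [NormedAddCommGroup E] [InnerProductSpace ℝ E] [FiniteDimensional ℝ E]
  [MeasurableSpace E] [BorelSpace E] {μ : Measure E} [μ.IsAddHaarMeasure]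
variable {F : Type*} [NormedAddCommGroup F] [NormedSpace ℝ F] [CompleteSpace F]

/-- **A continuous function with a continuous weak derivative is continuously differentiable**
(du Bois-Reymond's lemma in several variables; Evans, *PDE*, §5.3.1 Thm 1 read backwards): if `g`
is a weak Fréchet derivative of `f` on the open set `U`, and both `f` and `g` are continuous on `U`,
then `f` has the Fréchet derivative `g(x)` at every `x ∈ U`. Proof: on a ball `V ⋐ U` around `x`
the mollifications `φ_ε ⋆ 𝟙_V f` are `C¹` with derivative `φ_ε ⋆ 𝟙_V g`
(`HasWeakFDerivOn.hasFDerivAt_normed_convolution_indicator`); both converge locally uniformly (by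
uniform continuity on a compact ball) to `f` and `g`, and uniform limits of derivatives are
derivatives (`hasFDerivAt_of_tendstoLocallyUniformlyOn`). [folklore] -/
theorem HasWeakFDerivOn.hasFDerivAt_of_continuousOn {U : Opens E} {f : E → F} {g : E → E →L[ℝ] F}
    (hw : HasWeakFDerivOn U μ f g) (hf : ContinuousOn f U) (hg : ContinuousOn g U) {x : E}
    (hx : x ∈ (U : Set E)) : HasFDerivAt f (g x) x := by
  -- a ball `closedBall x (3R) ⊆ U`
  obtain ⟨R₀, hR₀, hball⟩ := Metric.isOpen_iff.1 U.isOpen x hx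
  set R : ℝ := R₀ / 5 with hR
  have hRpos : 0 < R := by positivity
  have hcb : closedBall x (4 * R) ⊆ (U : Set E) := fun y hy => hball (by
    rw [mem_closedBall] at hy; rw [mem_ball]; linarith)
  -- the open set `V = ball x (4R)` and its compact closure
  set V : Opens E := ⟨ball x (4 * R), isOpen_ball⟩ with hVdef
  have hVU : V ≤ U := fun y hy => hcb (ball_subset_closedBall hy)
  have hVm : MeasurableSet (V : Set E) := isOpen_ball.measurableSet
  have hK : IsCompact (closedBall x (4 * R)) := isCompact_closedBall _ _
  have hfK : ContinuousOn f (closedBall x (4 * R)) := hf.mono hcb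
  have hgK : ContinuousOn g (closedBall x (4 * R)) := hg.mono hcb
  -- integrability on `V`
  have hμV : μ (V : Set E) < ⊤ := measure_ball_lt_top
  haveI : IsFiniteMeasure (μ.restrict (V : Set E)) := ⟨by rwa [Measure.restrict_apply_univ]⟩
  obtain ⟨Cf, hCf⟩ := hK.exists_bound_of_continuousOn hfK
  obtain ⟨Cg, hCg⟩ := hK.exists_bound_of_continuousOn hgK
  have hfi : IntegrableOn f V μ :=
    memLp_one_iff_integrable.1 (MemLp.of_bound ((hf.mono hVU).aestronglyMeasurable hVm) Cf
      (ae_restrict_of_forall_mem hVm fun y hy => hCf y (ball_subset_closedBall hy)))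
  have hgi : IntegrableOn g V μ :=
    memLp_one_iff_integrable.1 (MemLp.of_bound ((hg.mono hVU).aestronglyMeasurable hVm) Cg
      (ae_restrict_of_forall_mem hVm fun y hy => hCg y (ball_subset_closedBall hy)))
  have hwV : HasWeakFDerivOn V μ f g := HasWeakFDerivOn.mono_set_holds hw hVU
  -- bumps with radii `R/(n+1)`
  set φ : ℕ → ContDiffBump (0 : E) := fun n =>
    ⟨R / (2 * ((n : ℝ) + 1)), R / ((n : ℝ) + 1), by positivity, by
      rw [div_lt_div_iff₀ (by positivity) (by positivity)]; nlinarith⟩ with hφ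
  have hrout : ∀ n, (φ n).rOut = R / ((n : ℝ) + 1) := fun n => rfl
  have hroutR : ∀ n, (φ n).rOut ≤ R := fun n => by
    rw [hrout, div_le_iff₀ (by positivity)]; nlinarith
  have hrout0 : Tendsto (fun n => (φ n).rOut) atTop (𝓝 0) := by
    simp_rw [hrout]
    have h := (tendsto_const_div_atTop_nhds_zero_nat R).comp (tendsto_add_atTop_nat 1)
    refine h.congr fun n => ?_
    simp [Nat.cast_succ]
  -- the approximants and their derivatives on `s = ball x R`
  set s : Set E := ball x R with hs
  set Fn : ℕ → E → F := fun n => (φ n).normed μ ⋆[ContinuousLinearMap.lsmul ℝ ℝ, μ] (V : Set E).indicator f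
  set Fn' : ℕ → E → E →L[ℝ] F := fun n y => ∫ z in (V : Set E), (φ n).normed μ (y - z) • g z ∂μ
  have hball_sub : ∀ n, ∀ y ∈ closedBall x (2 * R), closedBall y (φ n).rOut ⊆ (V : Set E) := fun n y hy z hz => by
    show z ∈ ball x (4 * R)
    rw [mem_closedBall] at hy hz; rw [mem_ball]
    calc dist z x ≤ dist z y + dist y x := dist_triangle _ _ _
      _ < 4 * R := by linarith [hroutR n]
  have hderiv : ∀ n, ∀ y ∈ s, HasFDerivAt (Fn n) (Fn' n y) y := fun n y hy =>
    hwV.hasFDerivAt_normed_convolution_indicator hfi hgi (φ n)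
      (hball_sub n y (ball_subset_closedBall (ball_subset_ball (by linarith) hy)))
  -- uniform continuity moduli on the compact ball
  have hucf := hK.uniformContinuousOn_of_continuous hfK
  have hucg := hK.uniformContinuousOn_of_continuous hgK
  -- pointwise convergence of `Fn`
  have hlim : ∀ y ∈ s, Tendsto (fun n => Fn n y) atTop (𝓝 (f y)) := fun y hy => by
    have hyK : y ∈ closedBall x (2 * R) := by
      rw [mem_closedBall]; rw [hs, mem_ball] at hy; linarith
    rw [Metric.tendsto_atTop]
    intro ε hε
    obtain ⟨δ, hδ, hδf⟩ := Metric.uniformContinuousOn_iff.1 hucf (ε / 2) (half_pos hε)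
    obtain ⟨N, hN⟩ := (Metric.tendsto_atTop.1 hrout0) δ hδ
    refine ⟨N, fun n hn => ?_⟩
    have hrn : (φ n).rOut < δ := by simpa [abs_of_pos (φ n).rOut_pos] using hN n hn
    have key := (φ n).dist_normed_convolution_le (μ := μ) (x₀ := y) (ε := ε / 2)
      ((hfi.integrable_indicator hVm).aestronglyMeasurable |>.mono_measure le_rfl) fun z hz => ?_
    · have hyV : y ∈ (V : Set E) := hball_sub n y hyK (mem_closedBall_self (φ n).rOut_pos.le)
      rw [Set.indicator_of_mem hyV] at key
      exact lt_of_le_of_lt key (half_lt_self hε)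
    · have hzV : z ∈ (V : Set E) := hball_sub n y hyK (ball_subset_closedBall hz)
      have hyV : y ∈ (V : Set E) := hball_sub n y hyK (mem_closedBall_self (φ n).rOut_pos.le)
      rw [Set.indicator_of_mem hzV, Set.indicator_of_mem hyV]
      refine (hδf z (ball_subset_closedBall hzV) y (ball_subset_closedBall hyV) ?_).le
      exact lt_trans (mem_ball.1 hz) hrn
  -- locally uniform convergence of the derivatives on `s`
  have hlim' : TendstoLocallyUniformlyOn Fn' g atTop s := by
    refine (Metric.tendstoUniformlyOn_iff.2 fun ε hε => ?_).tendstoLocallyUniformlyOn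
    obtain ⟨δ, hδ, hδg⟩ := Metric.uniformContinuousOn_iff.1 hucg (ε / 2) (half_pos hε)
    obtain ⟨N, hN⟩ := (Metric.tendsto_atTop.1 hrout0) δ hδ
    filter_upwards [Filter.eventually_ge_atTop N] with n hn y hy
    have hrn : (φ n).rOut < δ := by simpa [abs_of_pos (φ n).rOut_pos] using hN n hn
    have hyK : y ∈ closedBall x (2 * R) := by
      rw [mem_closedBall]; rw [hs, mem_ball] at hy; linarith
    have hyV : y ∈ (V : Set E) := hball_sub n y hyK (mem_closedBall_self (φ n).rOut_pos.le)
    have hrepr : Fn' n y = ((φ n).normed μ ⋆[ContinuousLinearMap.lsmul ℝ ℝ, μ] (V : Set E).indicator g) y := by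
      show (∫ z in (V : Set E), (φ n).normed μ (y - z) • g z ∂μ) = _
      rw [convolution_def, ← integral_sub_left_eq_self _ μ y, ← integral_indicator hVm]
      refine integral_congr_ae (Eventually.of_forall fun z => ?_)
      simp only [ContinuousLinearMap.lsmul_apply, sub_sub_cancel]
      by_cases hz : z ∈ (V : Set E) <;> simp [hz]
    have key := (φ n).dist_normed_convolution_le (μ := μ) (x₀ := y) (ε := ε / 2)
      ((hgi.integrable_indicator hVm).aestronglyMeasurable) fun z hz => ?_
    · rw [Set.indicator_of_mem hyV, ← hrepr] at key
      rw [dist_comm]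
      exact lt_of_le_of_lt key (half_lt_self hε)
    · have hzV : z ∈ (V : Set E) := hball_sub n y hyK (ball_subset_closedBall hz)
      rw [Set.indicator_of_mem hzV, Set.indicator_of_mem hyV]
      refine (hδg z (ball_subset_closedBall hzV) y (ball_subset_closedBall hyV) ?_).le
      exact lt_trans (mem_ball.1 hz) hrn
  exact hasFDerivAt_of_tendstoLocallyUniformlyOn isOpen_ball hlim' hderiv hlim (mem_ball_self hRpos)

end WeakToClassical

/-! ### `W^{m+2,2}(ℝ³) ⊂ C^m(ℝ³)` -/

section CmRep

variable {E' : Type*} [NormedAddCommGroup E'] [InnerProductSpace ℝ E'] [FiniteDimensional ℝ E']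
  [MeasurableSpace E'] [BorelSpace E'] {μ : Measure E'} [μ.IsAddHaarMeasure]
variable {F : Type*} [NormedAddCommGroup F] [NormedSpace ℝ F] [FiniteDimensional ℝ F]

/-- Dropping one order of a Sobolev function. [folklore] -/
theorem memSobolevDomain_of_succ_order {E₁ : Type*} [NormedAddCommGroup E₁] [NormedSpace ℝ E₁] [MeasurableSpace E₁]
    {F₁ : Type*} [NormedAddCommGroup F₁] [NormedSpace ℝ F₁] :
    ∀ {k : ℕ} {p : ℝ≥0∞} {Ω : Opens E₁} {μ : Measure E₁} {f : E₁ → F₁},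
      MemSobolevDomain (k + 1) p Ω μ f → MemSobolevDomain k p Ω μ f
  | 0, _, _, _, _, h => h.1
  | _ + 1, _, _, _, _, ⟨h0, g, hg, hgk⟩ => ⟨h0, g, hg, fun v => memSobolevDomain_of_succ_order (hgk v)⟩

/-- **`W^{m+2,2}(ℝ³) ⊂ C^m(ℝ³)`** (Adams, *Sobolev Spaces* (1975), Thm 5.4 Part II Case C' with
`j = m`; Evans, *PDE*, §5.6.3 Thm 6 (ii)): on a three-dimensional real inner product space, a
function with weak derivatives up to order `m + 2` in `L²` agrees a.e. with a `C^m` function.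
Induction on `m`: the case `m = 0` is the continuous representative of
`exists_continuous_rep_holder_eSobolevDomainNorm_two`; in the inductive step the function and the
components of its weak derivative have `C^m` representatives, and a continuous function with a
continuous weak derivative is classically differentiable with that derivative
(`HasWeakFDerivOn.hasFDerivAt_of_continuousOn`). [folklore] -/
theorem exists_contDiff_rep_of_memSobolevDomain (hE : finrank ℝ E' = 3) (m : ℕ) :
    ∀ {f : E' → F}, MemSobolevDomain (m + 2) 2 ⊤ μ f → ∃ f' : E' → F, f =ᵐ[μ] f' ∧ ContDiff ℝ m f' := by
  haveI : CompleteSpace F := FiniteDimensional.complete ℝ F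
  induction m with
  | zero =>
    intro f hf
    obtain ⟨K, -, hK⟩ := exists_continuous_rep_holder_eSobolevDomainNorm_two (μ := μ) (F := F) hE
    obtain ⟨g, hgc, hgf, -, -⟩ := hK f hf
    exact ⟨g, hgf.symm, contDiff_zero.2 hgc⟩
  | succ m ih =>
    intro f hf
    have hfm : MemSobolevDomain (m + 2) 2 ⊤ μ f := memSobolevDomain_of_succ_order hf
    obtain ⟨-, g, hw, hcomp⟩ := hf
    obtain ⟨f', hff', hf'c⟩ := ih hfm
    set b := stdOrthonormalBasis ℝ E' with hb
    have hgi : ∀ i, ∃ gi : E' → F, (fun x => g x (b i)) =ᵐ[μ] gi ∧ ContDiff ℝ m gi :=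
      fun i => ih (hcomp (b i))
    choose gi hgi hgic using hgi
    set G : E' → E' →L[ℝ] F := fun x => ∑ i, (innerSL ℝ (b i)).smulRight (gi i x) with hG
    have hGc : ContDiff ℝ m G :=
      ContDiff.sum fun i _ => (ContinuousLinearMap.smulRightL ℝ E' F (innerSL ℝ (b i))).contDiff.comp (hgic i)
    have hgG : g =ᵐ[μ] G := by
      have hall : ∀ᵐ x ∂μ, ∀ i, g x (b i) = gi i x := ae_all_iff.2 fun i => hgi i
      filter_upwards [hall] with x hx
      ext v
      calc g x v = g x (∑ i, ⟪b i, v⟫_ℝ • b i) := by rw [b.sum_repr' v]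
        _ = ∑ i, ⟪b i, v⟫_ℝ • g x (b i) := by simp [map_sum, map_smul]
        _ = G x v := by simp [hG, hx, ContinuousLinearMap.smulRight_apply]
    have hw' : HasWeakFDerivOn ⊤ μ f' G := by
      refine MeyersSerrin.hasWeakFDerivOn_congr_ae hw ?_ ?_
      · have : (μ.restrict ((⊤ : Opens E') : Set E')) = μ := by simp
        rw [this]; exact hff'.symm
      · have : (μ.restrict ((⊤ : Opens E') : Set E')) = μ := by simp
        rw [this]; exact hgG.symm
    have hderiv : ∀ x, HasFDerivAt f' (G x) x := fun x =>
      hw'.hasFDerivAt_of_continuousOn hf'c.continuous.continuousOn hGc.continuous.continuousOn (Set.mem_univ x)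
    refine ⟨f', hff', ?_⟩
    rw [show ((m + 1 : ℕ) : WithTop ℕ∞) = (m : WithTop ℕ∞) + 1 by push_cast; ring]
    exact contDiff_succ_iff_hasFDerivAt.2 ⟨G, hGc, hderiv⟩

end CmRep

end Literature.Analysis.FunctionSpaces
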